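/-
Copyright (c) 2026 the pub-hodgecm-mathlib formalisation cell (harness21).  Prover seat hodgecm-mathlib-LH4-p14 (g2), req620 Track A «(D-RAM) FOUR-FRAME» squad
(unit U3_Laws, MS ROAD A Stage B; brick B10 PART 2 «BOX RE-INDEX» dealt by the Stage-B lead LH4-p10 (g2) 2026-09-04T00:09:27Z; MS ledger LH4-p11 (g2); dealer LH4-plan (g11)).  2026-09-04.
-/
import Summits.HodgeConjecture.HodgeConjecture.Theorems.F0P3cDyRamStableCountSumPlanes   -- ★ B8 adapters (this seat): `stableCountSum_planes(_of_shift)`; brings ★ B8 `F0P3cDyRamStableCountSum`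
import Mathlib.Algebra.BigOperators.Fin
import Mathlib.Tactic.FinCases
import HarnessLib

/-!
# Crux `H413`, line LH4 «(D-RAM) FOUR-FRAME» road — unit U3_Laws (iii), MS ROAD A Stage B, brick B10 PART 2 «BOX RE-INDEX», FILE 1∕3: THE ENGINE —
# the sum of the stub table over the axis box `[0,B]³` decomposes along the diagonal and the three planes, and each piece is a block of ★ B8's per-plane class sum

Cell `hodgecm-mathlib` (D-0151), FLOOR 0, crux item H413 = `stmt-HodgeConjecture-24833`, route of record `HCCMUnconditional`; squad F0∕P3c∕LH4 (req618∕req620).  THEOREMS ONLY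
(no `def`, no instance, no notation, no `sorry`); lane `--supports stmt-HodgeConjecture-24833 --as helper` (count-neutral).  The B10 assembly (LH4-p10 (g2) SKELETON v1
`F0/P3c/LH4/LH4-p10/g2/B10-StableCountType{Zero,Two}.SKELETON.v1.LH4p10g2.lean` + ★ PART 1 p855987 `F0P3cDyRamStrataPartition`) writes the weighted count of the dualisable lattices as
`Σ_{a : Fin 3 → Fin (B+1)} v a` with `v a` = the weight of the axis stratum `a`, evaluated cell by cell by the Stage-B stubs (B3∕B4∕B5–B6∕§P∕B7).  This file is the
parity-generic re-indexing engine (pure `Finset` algebra over `ℚ`, no lattices):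
* §1 `vec3_eq_iff`, `sum_box_eq_triple_sum` — `Σ_{a : Fin 3 → Fin (B+1)} f a = Σ_{x,y,z ≤ B} f ![x,y,z]`;
* §2 `triple_sum_eq_diag_add_planes` — if `v` vanishes off the vectors with «two equal entries, not smaller than the third», the triple sum is the diagonal sum `Σ_r v(r,r,r)` plus
  the three plane sums `Σ_{r<t} v(r,t,t)`, `Σ_{r<t} v(t,r,t)`, `Σ_{r<t} v(t,t,r)`;
* §3 `plane_sum_eq` — ONE plane from the stub table in `r`-variables (`r = 2ρ` at type 0, `2ρ+1` at type 2; parity index `P`): on-branch `Σ_{s ≤ n, s ≡ P} q^{⌊s/2⌋}` + glued tube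
  `Σ_{r ≤ min(n′,n″), r ≡ P} Σ_{s even, r+s ≤ n} (q−1)q^{r+s/2−1}` + (this plane special: `n′ = n″ < n`) the glue shells `Σ_{n′<r≤2n′, r≡P, r−n′≤n′−d+1} q^{r+(n−n′)/2−⌈(r−n′)/2⌉}`;
* §4 `diag_sum_eq` — the diagonal: core `[P = 0]` + hanging `Σ_{r ≤ m, r ≡ P} (q−2)q^{r−1}` + (equilateral key) the glue shells.
FILE 2 assembles (`sum_box_eq_planes`, `sum_box_mul_eq`: `(q−1)·Σ_a v a = q^k − 1`); FILE 3 instantiates the two SKELETON tables VERBATIM.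
HONEST LABEL.  Count-neutral (`--supports`); finite-sum bookkeeping, nothing printed is asserted; (MS) stays a PROVER TARGET until B10 ⊕ B10₂ ⊕ (O2c) land; `HC_CM` is proved only modulo
the 7 printed citations (2 remaining named inputs: hLiu418 = `stmt-HodgeConjecture-24832`, h413 = `stmt-HodgeConjecture-24833`) until rung 0 closes.

## References
* [Rogawski1990] J. D. Rogawski, *Automorphic Representations of Unitary Groups in Three Variables*, Ann. of Math. Stud. 123 (1990), §4.9 Prop. 4.9.1 (a) p. 55.
* [Kottwitz1986BaseChangeUnits] R. E. Kottwitz, *Base change for unit elements of Hecke algebras*, Compositio Math. 60 (1986), §1 pp. 240–241.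
-/

set_option autoImplicit false

namespace Summit.HodgeConjecture.HodgeConjecture.Cruxes.H413.F0P3cDyRamStableCountBoxReindex

open Finset

/-! ## §1  Vectors of length three and the box sum as a triple sum -/

/-- `![a,b,c] = ![a',b',c'] ↔ a = a' ∧ b = b' ∧ c = c'`. [folklore] -/
theorem vec3_eq_iff {α : Type*} (a b c a' b' c' : α) : (![a, b, c] : Fin 3 → α) = ![a', b', c'] ↔ a = a' ∧ b = b' ∧ c = c' := by
  constructor
  · intro h
    exact ⟨by simpa using congrFun h 0, by simpa using congrFun h 1, by simpa using congrFun h 2⟩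
  · rintro ⟨rfl, rfl, rfl⟩; rfl

/-- **THE BOX SUM IS A TRIPLE SUM**: `Σ_{a : Fin 3 → Fin (B+1)} f(a) = Σ_{x,y,z ≤ B} f ![x,y,z]`. [folklore] -/
theorem sum_box_eq_triple_sum (B : ℕ) (f : (Fin 3 → ℕ) → ℚ) :
    ∑ a : Fin 3 → Fin (B + 1), f (fun i => (a i : ℕ)) = ∑ x ∈ range (B + 1), ∑ y ∈ range (B + 1), ∑ z ∈ range (B + 1), f ![x, y, z] := by
  have e : ∑ t : Fin (B + 1) × Fin (B + 1) × Fin (B + 1), f ![(t.1 : ℕ), (t.2.1 : ℕ), (t.2.2 : ℕ)] =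
      ∑ a : Fin 3 → Fin (B + 1), f (fun i => (a i : ℕ)) := by
    refine Fintype.sum_bijective (fun t : Fin (B + 1) × Fin (B + 1) × Fin (B + 1) => (![t.1, t.2.1, t.2.2] : Fin 3 → Fin (B + 1)))
      ⟨?_, ?_⟩ _ _ (fun t => ?_)
    · intro t t' h
      obtain ⟨h1, h2, h3⟩ := (vec3_eq_iff _ _ _ _ _ _).1 h
      exact Prod.ext h1 (Prod.ext h2 h3)
    · intro a
      exact ⟨(a 0, a 1, a 2), by funext i; fin_cases i <;> rfl⟩
    · congr 1
      funext i
      fin_cases i <;> rfl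
  rw [← e, Fintype.sum_prod_type' (fun (x : Fin (B + 1)) (p : Fin (B + 1) × Fin (B + 1)) => f ![(x : ℕ), (p.1 : ℕ), (p.2 : ℕ)])]
  have inner : ∀ x : Fin (B + 1), ∑ p : Fin (B + 1) × Fin (B + 1), f ![(x : ℕ), (p.1 : ℕ), (p.2 : ℕ)] =
      ∑ y ∈ range (B + 1), ∑ z ∈ range (B + 1), f ![(x : ℕ), y, z] := by
    intro x
    rw [Fintype.sum_prod_type' (fun (y : Fin (B + 1)) (z : Fin (B + 1)) => f ![(x : ℕ), (y : ℕ), (z : ℕ)])]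
    rw [← Fin.sum_univ_eq_sum_range (fun y => ∑ z ∈ range (B + 1), f ![(x : ℕ), y, z]) (B + 1)]
    refine Finset.sum_congr rfl fun y _ => ?_
    rw [Fin.sum_univ_eq_sum_range (fun z => f ![(x : ℕ), (y : ℕ), z]) (B + 1)]
  simp only [inner]
  rw [← Fin.sum_univ_eq_sum_range (fun x => ∑ y ∈ range (B + 1), ∑ z ∈ range (B + 1), f ![x, y, z]) (B + 1)]

/-! ## §2  Decomposition of the triple sum along the diagonal and the three planes -/

/-- **THE FOUR REGULAR SHAPES**: if `v` vanishes off the vectors with «two equal entries not smaller than the third», the triple sum splits into the diagonal `Σ_r v(r,r,r)` and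
three plane sums `Σ_{r<t} v(r,t,t)`, `Σ_{r<t} v(t,r,t)`, `Σ_{r<t} v(t,t,r)`. [folklore] -/
theorem triple_sum_eq_diag_add_planes (B : ℕ) (v : (Fin 3 → ℕ) → ℚ)
    (hreg : ∀ x y z : ℕ, v ![x, y, z] ≠ 0 → (x = y ∧ y = z) ∨ (y = z ∧ x < y) ∨ (x = z ∧ y < x) ∨ (x = y ∧ z < x)) :
    ∑ x ∈ range (B + 1), ∑ y ∈ range (B + 1), ∑ z ∈ range (B + 1), v ![x, y, z] =
      ∑ r ∈ range (B + 1), v ![r, r, r]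
      + ∑ r ∈ range (B + 1), ∑ t ∈ range (B + 1), (if r < t then v ![r, t, t] else 0)
      + ∑ r ∈ range (B + 1), ∑ t ∈ range (B + 1), (if r < t then v ![t, r, t] else 0)
      + ∑ r ∈ range (B + 1), ∑ t ∈ range (B + 1), (if r < t then v ![t, t, r] else 0) := by
  -- pointwise split into the four exclusive cases
  have hpt : ∀ x y z : ℕ, v ![x, y, z] =
      (if x = y ∧ y = z then v ![x, y, z] else 0) + (if y = z ∧ x < y then v ![x, y, z] else 0)
        + (if x = z ∧ y < x then v ![x, y, z] else 0) + (if x = y ∧ z < x then v ![x, y, z] else 0) := by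
    intro x y z
    by_cases h0 : v ![x, y, z] = 0
    · simp [h0]
    rcases hreg x y z h0 with h | h | h | h
    · rw [if_pos h, if_neg (by omega), if_neg (by omega), if_neg (by omega)]; ring
    · rw [if_neg (by omega), if_pos h, if_neg (by omega), if_neg (by omega)]; ring
    · rw [if_neg (by omega), if_neg (by omega), if_pos h, if_neg (by omega)]; ring
    · rw [if_neg (by omega), if_neg (by omega), if_neg (by omega), if_pos h]; ring
  rw [show (∑ x ∈ range (B + 1), ∑ y ∈ range (B + 1), ∑ z ∈ range (B + 1), v ![x, y, z]) =
      ∑ x ∈ range (B + 1), ∑ y ∈ range (B + 1), ∑ z ∈ range (B + 1),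
        ((if x = y ∧ y = z then v ![x, y, z] else 0) + (if y = z ∧ x < y then v ![x, y, z] else 0)
          + (if x = z ∧ y < x then v ![x, y, z] else 0) + (if x = y ∧ z < x then v ![x, y, z] else 0)) from
    Finset.sum_congr rfl fun x _ => Finset.sum_congr rfl fun y _ => Finset.sum_congr rfl fun z _ => hpt x y z]
  simp only [Finset.sum_add_distrib]
  congr 1; congr 1; congr 1
  · -- diagonal
    refine Finset.sum_congr rfl fun x hx => ?_
    rw [Finset.sum_eq_single_of_mem x hx (fun y _ hyx => Finset.sum_eq_zero fun z _ => if_neg (by omega))]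
    rw [Finset.sum_eq_single_of_mem x hx (fun z _ hzx => if_neg (by omega))]
    rw [if_pos ⟨rfl, rfl⟩]
  · -- plane 1: `z = t := y`
    refine Finset.sum_congr rfl fun x _ => Finset.sum_congr rfl fun y hy => ?_
    rw [Finset.sum_eq_single_of_mem y hy (fun z _ hzy => if_neg (by omega))]
    by_cases h : x < y
    · rw [if_pos ⟨rfl, h⟩, if_pos h]
    · rw [if_neg (by omega), if_neg h]
  · -- plane 2: `z = x`, then swap the roles of `x` and `y`
    rw [Finset.sum_comm]
    refine Finset.sum_congr rfl fun y _ => Finset.sum_congr rfl fun x hx => ?_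
    rw [Finset.sum_eq_single_of_mem x hx (fun z _ hzx => if_neg (by omega))]
    by_cases h : y < x
    · rw [if_pos ⟨rfl, h⟩, if_pos h]
    · rw [if_neg (by omega), if_neg h]
  · -- plane 3: `y = x`, then swap the roles of `x` and `z`
    have : ∀ x ∈ range (B + 1), ∑ y ∈ range (B + 1), ∑ z ∈ range (B + 1), (if x = y ∧ z < x then v ![x, y, z] else 0) =
        ∑ z ∈ range (B + 1), (if z < x then v ![x, x, z] else 0) := by
      intro x hx
      rw [Finset.sum_eq_single_of_mem x hx (fun y _ hyx => Finset.sum_eq_zero fun z _ => if_neg (by omega))]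
      refine Finset.sum_congr rfl fun z _ => ?_
      by_cases h : z < x
      · rw [if_pos ⟨rfl, h⟩, if_pos h]
      · rw [if_neg (by omega), if_neg h]
    rw [Finset.sum_congr rfl this, Finset.sum_comm]


/-! ## §3  Evaluation of one plane sum from the stub table -/

/-- **ONE PLANE.**  Let `φ r t` (`r < t`) be the weight of the axis vector with `r` on the plane's own slot and `t` on the two others (so `t = r + s`, `s ≥ 1` the distance to the
branch); plane depth `n`, the other two depths `n'`, `n''`.  If `φ` follows the Stage-B stub table — on-branch values at `r = 0`, tube + glue values at `r ≥ 1` of parity `P`,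
zero at `r ≥ 1` of the other parity — then `Σ_{r<t≤B} φ r t` is the plane's on-branch block + tube block + (if this plane is the special one) glue block of ★ `stableCountSum_planes`.
[folklore] -/
theorem plane_sum_eq (q P : ℕ) {n n' n'' d B : ℕ} (hd : 1 ≤ d) (hdn' : d ≤ n') (hnn'B : n + n' ≤ B) (φ : ℕ → ℕ → ℚ)
    (hT : ∀ s, 1 ≤ s → φ 0 s = if s % 2 = P ∧ s ≤ n then (q : ℚ) ^ (s / 2) else 0)
    (hG : ∀ r s, 1 ≤ r → r % 2 = P → 1 ≤ s → φ r (r + s) =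
      (if s % 2 = 0 ∧ r ≤ min n' n'' ∧ r + s ≤ n then ((q : ℚ) - 1) * (q : ℚ) ^ (r + s / 2 - 1) else 0) +
      (if s % 2 = 0 ∧ n' = n'' ∧ n = n' + s ∧ n' < r ∧ r - n' ≤ n' - d + 1 then (q : ℚ) ^ (r + s / 2 - (r - n' + 1) / 2) else 0))
    (hZ : ∀ r s, 1 ≤ r → r % 2 ≠ P → 1 ≤ s → φ r (r + s) = 0) :
    ∑ r ∈ range (B + 1), ∑ t ∈ range (B + 1), (if r < t then φ r t else 0) =
      ∑ s ∈ (Icc 1 n).filter (fun s => s % 2 = P), (q : ℚ) ^ (s / 2)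
      + ∑ r ∈ (Icc 1 (min n' n'')).filter (fun r => r % 2 = P),
          ∑ s ∈ (Icc 2 (n - r)).filter (fun s => s % 2 = 0), ((q : ℚ) - 1) * (q : ℚ) ^ (r + s / 2 - 1)
      + (if n' = n'' ∧ n' < n ∧ (n - n') % 2 = 0 then
          ∑ r ∈ (Icc (n' + 1) (2 * n')).filter (fun r => r % 2 = P ∧ r - n' ≤ n' - d + 1), (q : ℚ) ^ (r + (n - n') / 2 - (r - n' + 1) / 2)
        else 0) := by
  -- pointwise expansion of the summand into on-branch + tube + glue indicator terms
  have hexp : ∀ r t : ℕ, (if r < t then φ r t else 0) =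
      (if r = 0 ∧ 1 ≤ t ∧ t % 2 = P ∧ t ≤ n then (q : ℚ) ^ (t / 2) else 0)
      + (if 1 ≤ r ∧ r < t ∧ r % 2 = P ∧ (t - r) % 2 = 0 ∧ r ≤ min n' n'' ∧ t ≤ n then ((q : ℚ) - 1) * (q : ℚ) ^ (r + (t - r) / 2 - 1) else 0)
      + (if 1 ≤ r ∧ r < t ∧ r % 2 = P ∧ (t - r) % 2 = 0 ∧ n' = n'' ∧ n = n' + (t - r) ∧ n' < r ∧ r - n' ≤ n' - d + 1
          then (q : ℚ) ^ (r + (t - r) / 2 - (r - n' + 1) / 2) else 0) := by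
    intro r t
    rcases Nat.lt_or_ge r t with hrt | hrt
    · rw [if_pos hrt]
      obtain ⟨s, hs1, rfl⟩ : ∃ s, 1 ≤ s ∧ t = r + s := ⟨t - r, by omega, by omega⟩
      simp only [Nat.add_sub_cancel_left]
      rcases Nat.eq_zero_or_pos r with rfl | hrpos
      · simp only [zero_add]
        rw [hT s hs1, if_neg (fun h : 1 ≤ 0 ∧ _ => absurd h.1 (by omega)), if_neg (fun h : 1 ≤ 0 ∧ _ => absurd h.1 (by omega)),
          add_zero, add_zero]
        by_cases h : s % 2 = P ∧ s ≤ n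
        · rw [if_pos h, if_pos ⟨trivial, hs1, h⟩]
        · rw [if_neg h, if_neg (fun h' => h h'.2.2)]
      · by_cases hrP : r % 2 = P
        · rw [hG r s hrpos hrP hs1]
          split_ifs <;> first | ring1 | (exfalso; omega)
        · rw [hZ r s hrpos hrP hs1]
          split_ifs <;> first | ring1 | (exfalso; omega)
    · rw [if_neg (by omega)]
      split_ifs <;> first | ring1 | (exfalso; omega)
  simp only [hexp, Finset.sum_add_distrib]
  congr 1; congr 1
  · -- on-branch block: only `r = 0` contributes
    rw [Finset.sum_eq_single_of_mem 0 (by simp) (fun r _ hr => Finset.sum_eq_zero fun t _ => if_neg (by omega))]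
    rw [← Finset.sum_filter]
    refine (Finset.sum_congr ?_ fun _ _ => rfl).symm
    ext t
    simp only [Finset.mem_filter, Finset.mem_Icc, Finset.mem_range]
    constructor
    · rintro ⟨⟨h1, h2⟩, h3⟩; exact ⟨by omega, trivial, h1, h3, h2⟩
    · rintro ⟨h0, -, h1, h3, h2⟩; exact ⟨⟨h1, h2⟩, h3⟩
  · -- tube block
    have hsub : (Icc 1 (min n' n'')).filter (fun r => r % 2 = P) ⊆ range (B + 1) := by
      intro r hr
      simp only [Finset.mem_filter, Finset.mem_Icc] at hr
      simp only [Finset.mem_range]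
      have := min_le_left n' n''
      omega
    rw [← Finset.inter_eq_right.2 hsub, ← Finset.sum_ite_mem]
    refine Finset.sum_congr rfl fun r hr => ?_
    by_cases hrI : r ∈ (Icc 1 (min n' n'')).filter (fun r => r % 2 = P)
    · rw [if_pos hrI]
      simp only [Finset.mem_filter, Finset.mem_Icc] at hrI
      rw [← Finset.sum_filter]
      refine Finset.sum_nbij' (fun t => t - r) (fun s => r + s) ?_ ?_ ?_ ?_ ?_
      · intro t ht
        simp only [Finset.mem_filter, Finset.mem_range, Finset.mem_Icc] at ht ⊢; omega
      · intro s hs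
        simp only [Finset.mem_filter, Finset.mem_range, Finset.mem_Icc] at hs ⊢
        refine ⟨by omega, by omega, by omega, hrI.2, by omega, hrI.1.2, by omega⟩
      · intro t ht; simp only [Finset.mem_filter, Finset.mem_range] at ht; omega
      · intro s _; omega
      · intro t _; rfl
    · rw [if_neg hrI]
      simp only [Finset.mem_filter, Finset.mem_Icc] at hrI
      exact Finset.sum_eq_zero fun t _ => if_neg (by omega)
  · -- glue block: the inner sum collapses at `t = r + (n − n')`
    by_cases hc : n' = n'' ∧ n' < n ∧ (n - n') % 2 = 0
    · rw [if_pos hc]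
      obtain ⟨hc1, hc2, hc3⟩ := hc
      have hsub : (Icc (n' + 1) (2 * n')).filter (fun r => r % 2 = P ∧ r - n' ≤ n' - d + 1) ⊆ range (B + 1) := by
        intro r hr
        simp only [Finset.mem_filter, Finset.mem_Icc] at hr
        simp only [Finset.mem_range]; omega
      rw [← Finset.inter_eq_right.2 hsub, ← Finset.sum_ite_mem]
      refine Finset.sum_congr rfl fun r hr => ?_
      simp only [Finset.mem_range] at hr
      rw [Finset.sum_eq_single (r + (n - n'))]
      · simp only [Nat.add_sub_cancel_left, Finset.mem_filter, Finset.mem_Icc]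
        by_cases hcond : (n' + 1 ≤ r ∧ r ≤ 2 * n') ∧ r % 2 = P ∧ r - n' ≤ n' - d + 1
        · rw [if_pos hcond, if_pos]
          refine ⟨by omega, by omega, hcond.2.1, hc3, hc1, by omega, by omega, hcond.2.2⟩
        · rw [if_neg hcond, if_neg]
          rintro ⟨h1, -, h3, -, -, -, h7, h8⟩
          exact hcond ⟨⟨by omega, by omega⟩, h3, h8⟩
      · intro t _ ht
        refine if_neg fun h => ht ?_
        obtain ⟨-, -, -, -, -, h6, -, -⟩ := h
        omega
      · intro ht
        simp only [Finset.mem_range] at ht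
        refine if_neg fun h => ht ?_
        obtain ⟨-, -, -, -, -, h6, h7, h8⟩ := h
        omega
    · rw [if_neg hc]
      refine Finset.sum_eq_zero fun r _ => Finset.sum_eq_zero fun t _ => if_neg ?_
      rintro ⟨h1, h2, -, h4, h5, h6, h7, -⟩
      exact hc ⟨h5, by omega, by omega⟩


/-! ## §4  Evaluation of the diagonal sum from the stub table -/

/-- **THE DIAGONAL.**  If `ψ r` (the weight of the axis vector `(r,r,r)`) follows the stub table — core value `[P = 0]` at `r = 0`, hanging + equilateral-glue values at `r ≥ 1` of parity
`P`, zero at the other parity — then `Σ_{r ≤ B} ψ r` is the core + the hanging block + (equilateral key) the glue block of ★ `stableCountSum_planes`. [folklore] -/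
theorem diag_sum_eq (q P : ℕ) {n₁ n₂ n₃ d B : ℕ} (hd : 1 ≤ d) (hdn : d ≤ min n₁ (min n₂ n₃)) (hB : n₁ + n₂ + n₃ ≤ B) (ψ : ℕ → ℚ)
    (h0 : ψ 0 = if P = 0 then 1 else 0)
    (hH : ∀ r, 1 ≤ r → r % 2 = P → ψ r =
      (if r ≤ min n₁ (min n₂ n₃) then ((q : ℚ) - 2) * (q : ℚ) ^ (r - 1) else 0) +
      (if n₁ = n₂ ∧ n₂ = n₃ ∧ n₁ < r ∧ r - n₁ ≤ n₁ - d + 1 then (q : ℚ) ^ (r - (r - n₁ + 1) / 2) else 0))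
    (hZ : ∀ r, 1 ≤ r → r % 2 ≠ P → ψ r = 0) :
    ∑ r ∈ range (B + 1), ψ r =
      (if P = 0 then (1 : ℚ) else 0)
      + ∑ r ∈ (Icc 1 (min n₁ (min n₂ n₃))).filter (fun r => r % 2 = P), ((q : ℚ) - 2) * (q : ℚ) ^ (r - 1)
      + (if n₁ = n₂ ∧ n₂ = n₃ then
          ∑ r ∈ (Icc (n₁ + 1) (2 * n₁)).filter (fun r => r % 2 = P ∧ r - n₁ ≤ n₁ - d + 1), (q : ℚ) ^ (r - (r - n₁ + 1) / 2) else 0) := by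
  have hm₁ : min n₁ (min n₂ n₃) ≤ n₁ := min_le_left _ _
  have hexp : ∀ r : ℕ, ψ r = (if r = 0 ∧ P = 0 then (1 : ℚ) else 0)
      + (if 1 ≤ r ∧ r % 2 = P ∧ r ≤ min n₁ (min n₂ n₃) then ((q : ℚ) - 2) * (q : ℚ) ^ (r - 1) else 0)
      + (if 1 ≤ r ∧ r % 2 = P ∧ n₁ = n₂ ∧ n₂ = n₃ ∧ n₁ < r ∧ r - n₁ ≤ n₁ - d + 1 then (q : ℚ) ^ (r - (r - n₁ + 1) / 2) else 0) := by
    intro r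
    rcases Nat.eq_zero_or_pos r with rfl | hrpos
    · rw [h0, if_neg (fun h : 1 ≤ 0 ∧ _ => absurd h.1 (by omega)), if_neg (fun h : 1 ≤ 0 ∧ _ => absurd h.1 (by omega)), add_zero, add_zero]
      by_cases hP : P = 0
      · rw [if_pos hP, if_pos ⟨rfl, hP⟩]
      · rw [if_neg hP, if_neg (fun h => hP h.2)]
    · by_cases hrP : r % 2 = P
      · rw [hH r hrpos hrP, if_neg (fun h : r = 0 ∧ _ => absurd h.1 (by omega)), zero_add]
        split_ifs <;> first | ring1 | (exfalso; omega)
      · rw [hZ r hrpos hrP]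
        split_ifs <;> first | ring1 | (exfalso; omega)
  simp only [hexp, Finset.sum_add_distrib]
  congr 1; congr 1
  · rw [Finset.sum_eq_single_of_mem 0 (by simp) (fun r _ hr => if_neg (fun h => hr h.1))]
    by_cases hP : P = 0
    · rw [if_pos ⟨rfl, hP⟩, if_pos hP]
    · rw [if_neg (fun h => hP h.2), if_neg hP]
  · rw [← Finset.sum_filter]
    refine Finset.sum_congr ?_ fun _ _ => rfl
    ext r
    simp only [Finset.mem_filter, Finset.mem_range, Finset.mem_Icc]
    constructor
    · rintro ⟨-, h1, h2, h3⟩; exact ⟨⟨h1, h3⟩, h2⟩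
    · rintro ⟨⟨h1, h3⟩, h2⟩; exact ⟨by omega, h1, h2, h3⟩
  · by_cases he : n₁ = n₂ ∧ n₂ = n₃
    · rw [if_pos he, ← Finset.sum_filter]
      refine Finset.sum_congr ?_ fun _ _ => rfl
      ext r
      simp only [Finset.mem_filter, Finset.mem_range, Finset.mem_Icc]
      constructor
      · rintro ⟨-, h1, h2, -, -, h5, h6⟩; exact ⟨⟨by omega, by omega⟩, h2, h6⟩
      · rintro ⟨⟨h1, h3⟩, h2, h6⟩; exact ⟨by omega, by omega, h2, he.1, he.2, by omega, h6⟩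
    · rw [if_neg he]
      refine Finset.sum_eq_zero fun r _ => if_neg ?_
      rintro ⟨-, -, h3, h4, -, -⟩
      exact he ⟨h3, h4⟩

end Summit.HodgeConjecture.HodgeConjecture.Cruxes.H413.F0P3cDyRamStableCountBoxReindex
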